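import Mathlib
import HarnessLib
import Literature.Analysis.FluidPDE.LocalTypeI
import Literature.Analysis.FluidPDE.SelfSimilar
import Summits.NavierStokesRegularity.NavierStokesRegularity.Theses.DulacContraction

/-!
# Crux `ForcedSymmetry` (stmt-NavierStokesRegularity-4052), line `recurrent-closing`, stub `stub_rdssLiouville`
# (= route item stmt-NavierStokesRegularity-8561 `DulacContraction.RDSSLiouvilleInClass`): reduction to the centre time `τ = 0`

Route `SymmetryModuliCount`, sub-problem `NavierStokesRegularity`.  Lead seat c3 (2026-08-17), recording the stub audit
of wave 1 (evidence `StubRdssLiouvilleAudit.md` on the crux item) as kernel-checked theorems.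

`RDSSLiouvilleInClass` asks that a smooth local-energy Type-I slab profile `w`, invariant a.e. on `t < 0` under ONE
similarity `(t, x) ↦ l • R⁻¹ w (l² t + τ, l R x + ξ)` with `l > 1`, `τ ≤ 0`, be regular at the space–time origin.  The fixed
time of `t ↦ l² t + τ` is `t* = −τ/(l² − 1) ≥ 0`.  For `τ < 0` (`t* > 0`) the statement is ELEMENTARY: a.e. on the slab
`‖w(t,x)‖ = l ‖w(l²t + τ, ·)‖ ≤ l C/√(−(l²t+τ)) ≤ l C/√(−τ)` by the Type-I time decay alone, so `w` is essentially bounded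
on the whole slab and the origin is not a backward singular point.  Hence the item is EQUIVALENT to its `τ = 0` core (centre
on the final time slice: Tsai's Type-I λ-DSS Liouville conjecture for every `λ > 1` at the centre `x* = 0`, the off-centre
case `x* ≠ 0`, and the RDSS versions) — the genuinely open part (Bradshaw–Tsai 2017 OP 5.1; Tsai 2018 Conj. 8.8–8.9;
Pineau–Vicol 2026 Conj. 1.1).

* `not_isBackwardSingularPoint_of_rdssInvariant_of_neg` — the `τ < 0` case from `HasTypeITimeDecay` + a.e. invariance only;
* `rdssLiouvilleInClass_iff_centreTimeZero` — `RDSSLiouvilleInClass ↔` (the same statement with `τ = 0`);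
* `rdssInvariant_pointwise_of_classical` (appended) — for classical profiles the a.e. clause holds pointwise on `t < 0`.

References: T.-P. Tsai, *Lectures on Navier–Stokes equations* (AMS 2018), Conj. 8.8–8.9 [Tsai2018]; Z. Bradshaw,
T.-P. Tsai, CPDE 42 (2017), OP 5.1 [BradshawTsai2017CPDE].
-/

noncomputable section

-- the summit and its single problem share the name (D-0017 nested layout)
set_option linter.dupNamespace false

open MeasureTheory Set Function
open scoped ENNReal
open Literature.Analysis.FluidPDE

namespace Summit.NavierStokesRegularity.NavierStokesRegularity.Theorems.SymmetryModuliCountForcedSymmetry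

/-- **The `τ < 0` case of `RDSSLiouvilleInClass` is elementary.**  If `w` has the Type-I time decay `‖w t x‖ ≤ C/√(−t)`
and is invariant a.e. on the slab `t < 0` under the similarity `(t,x) ↦ l • R⁻¹ (w (l²t + τ) (l R x + ξ))` with `l > 1` and
`τ < 0`, then `w` is essentially bounded by `l C/√(−τ)` on the slab, so the origin is not a backward singular point.
(No Navier–Stokes input.) [folklore] -/
theorem not_isBackwardSingularPoint_of_rdssInvariant_of_neg
    {w : ℝ → EuclideanSpace ℝ (Fin 3) → EuclideanSpace ℝ (Fin 3)} {C l τ : ℝ}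
    (R : EuclideanSpace ℝ (Fin 3) ≃ₗᵢ[ℝ] EuclideanSpace ℝ (Fin 3)) (ξ : EuclideanSpace ℝ (Fin 3))
    (hdecay : HasTypeITimeDecay C w) (hl : 1 < l) (hτ : τ < 0)
    (hinv : (fun z : ℝ × EuclideanSpace ℝ (Fin 3) => l • R.symm (w (l ^ 2 * z.1 + τ) (l • R z.2 + ξ)))
      =ᵐ[volume.restrict (Iio (0 : ℝ) ×ˢ (univ : Set (EuclideanSpace ℝ (Fin 3))))]
      (fun z : ℝ × EuclideanSpace ℝ (Fin 3) => w z.1 z.2)) :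
    ¬ IsBackwardSingularPoint w 0 := by
  intro hsing
  have hC : 0 ≤ C := by
    have h := hdecay (-1) (by norm_num) 0
    rw [neg_neg, Real.sqrt_one, div_one] at h
    exact (norm_nonneg _).trans h
  have hl0 : 0 < l := by linarith
  have hsτ : 0 < Real.sqrt (-τ) := Real.sqrt_pos.2 (by linarith)
  -- a.e. bound on the whole slab `t < 0`
  have hbound : ∀ᵐ z ∂(volume.restrict (Iio (0 : ℝ) ×ˢ (univ : Set (EuclideanSpace ℝ (Fin 3))))),
      ‖uncurry w z‖ ≤ l * (C / Real.sqrt (-τ)) := by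
    have hmem : ∀ᵐ z ∂(volume.restrict (Iio (0 : ℝ) ×ˢ (univ : Set (EuclideanSpace ℝ (Fin 3))))),
        z ∈ Iio (0 : ℝ) ×ˢ (univ : Set (EuclideanSpace ℝ (Fin 3))) :=
      ae_restrict_mem (measurableSet_Iio.prod MeasurableSet.univ)
    filter_upwards [hinv, hmem] with z hz hzmem
    have ht : z.1 < 0 := by
      simp only [mem_prod, mem_Iio, mem_univ, and_true] at hzmem
      exact hzmem
    have hl2 : 0 < l ^ 2 := by positivity
    have hprod : l ^ 2 * z.1 < 0 := mul_neg_of_pos_of_neg hl2 ht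
    have hs : l ^ 2 * z.1 + τ < 0 := by linarith
    show ‖w z.1 z.2‖ ≤ _
    rw [← hz, norm_smul, Real.norm_of_nonneg hl0.le, LinearIsometryEquiv.norm_map]
    refine mul_le_mul_of_nonneg_left ?_ hl0.le
    refine (hdecay _ hs _).trans ?_
    exact div_le_div_of_nonneg_left hC hsτ (Real.sqrt_le_sqrt (by linarith))
  have hsub : parabolicCylinder (1 : ℝ) (0 : ℝ × EuclideanSpace ℝ (Fin 3)) ⊆
      Iio (0 : ℝ) ×ˢ (univ : Set (EuclideanSpace ℝ (Fin 3))) := by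
    intro z hz
    rw [mem_parabolicCylinder] at hz
    refine ⟨?_, mem_univ _⟩
    have h2 := hz.1.2
    simpa using h2
  have hle : eLpNorm (uncurry w) ∞ (volume.restrict (parabolicCylinder (1 : ℝ) (0 : ℝ × EuclideanSpace ℝ (Fin 3))))
      ≤ eLpNorm (uncurry w) ∞ (volume.restrict (Iio (0 : ℝ) ×ˢ (univ : Set (EuclideanSpace ℝ (Fin 3))))) :=
    eLpNorm_mono_measure _ (Measure.restrict_mono hsub le_rfl)
  have hfin : eLpNorm (uncurry w) ∞ (volume.restrict (Iio (0 : ℝ) ×ˢ (univ : Set (EuclideanSpace ℝ (Fin 3)))))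
      ≤ ENNReal.ofReal (l * (C / Real.sqrt (-τ))) := by
    rw [eLpNorm_exponent_top]
    exact eLpNormEssSup_le_of_ae_bound hbound
  rw [hsing 1 one_pos] at hle
  exact ENNReal.ofReal_ne_top (top_le_iff.1 (hle.trans hfin))

/-- **`RDSSLiouvilleInClass` (stmt-8561) is equivalent to its centre-time-zero core.**  The right-hand side is the item's
statement with the time shift frozen at `τ = 0` (similarity `(t,x) ↦ l • R⁻¹ w (l² t, l R x + ξ)`, centre on the final
slice `t = 0`); the case `τ < 0` of the item is discharged by `not_isBackwardSingularPoint_of_rdssInvariant_of_neg`.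
So the open content of the stub `stub_rdssLiouville` of the line `recurrent-closing` is exactly: Type-I (R)DSS slab
profiles of the local-energy class centred on the final time slice are regular at the origin (Tsai 2018, Conj. 8.8–8.9;
Bradshaw–Tsai 2017, OP 5.1). [cite: Tsai2018, Conj. 8.8–8.9; BradshawTsai2017CPDE, OP 5.1] -/
theorem rdssLiouvilleInClass_iff_centreTimeZero :
    Summit.NavierStokesRegularity.NavierStokesRegularity.Theses.DulacContraction.RDSSLiouvilleInClass ↔
      ∀ (w : ℝ → EuclideanSpace ℝ (Fin 3) → EuclideanSpace ℝ (Fin 3)) (q : ℝ → EuclideanSpace ℝ (Fin 3) → ℝ)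
        (H : ℝ → EuclideanSpace ℝ (Fin 3) → EuclideanSpace ℝ (Fin 3) →L[ℝ] EuclideanSpace ℝ (Fin 3)) (C : ℝ),
        IsSuitableWeakSolutionOn (slab (EuclideanSpace ℝ (Fin 3)) (Set.Iio 0) isOpen_Iio) 1 0 w q →
        HasWeakSpatialGradientOn (slab (EuclideanSpace ℝ (Fin 3)) (Set.Iio 0) isOpen_Iio) w H →
        typeIBound (Set.Iio (0 : ℝ) ×ˢ Set.univ) w q H < ⊤ →
        HasTypeITimeDecay C w →
        IsClassicalNSSolutionOn (Set.Iio 0) 1 0 w q →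
        (∃ l : ℝ, 1 < l ∧ ∃ (R : EuclideanSpace ℝ (Fin 3) ≃ₗᵢ[ℝ] EuclideanSpace ℝ (Fin 3)) (ξ : EuclideanSpace ℝ (Fin 3)),
          (fun z : ℝ × EuclideanSpace ℝ (Fin 3) => l • R.symm (w (l ^ 2 * z.1) (l • R z.2 + ξ)))
            =ᵐ[volume.restrict (Set.Iio (0 : ℝ) ×ˢ Set.univ)]
          (fun z : ℝ × EuclideanSpace ℝ (Fin 3) => w z.1 z.2)) →
        ¬ IsBackwardSingularPoint w 0 := by
  constructor
  · intro h w q H C hsw hwg hI hdec hcl hinv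
    obtain ⟨l, hl, R, ξ, hae⟩ := hinv
    refine h w q H C hsw hwg hI hdec hcl ⟨l, hl, R, ξ, 0, le_rfl, ?_⟩
    simpa only [add_zero] using hae
  · intro h w q H C hsw hwg hI hdec hcl hinv
    obtain ⟨l, hl, R, ξ, τ, hτ, hae⟩ := hinv
    rcases hτ.lt_or_eq with hτ0 | hτ0
    · exact not_isBackwardSingularPoint_of_rdssInvariant_of_neg R ξ hdec hl hτ0 hae
    · subst hτ0
      refine h w q H C hsw hwg hI hdec hcl ⟨l, hl, R, ξ, ?_⟩
      simpa only [add_zero] using hae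

/-! ### Appended (lead c3, 2026-08-17): a.e. invariance is pointwise invariance for classical profiles -/

/-- **For a classical profile the a.e. RDSS clause holds pointwise on the open slab.**  If `w` is classical on `(−∞,0)`
(jointly smooth, hence continuous on `Iio 0 ×ˢ univ`) and invariant a.e. on the slab under the similarity
`(t,x) ↦ l • R⁻¹ w (l² t + τ, l • R x + ξ)` with `τ ≤ 0`, then the identity holds for EVERY `t < 0` and `x`: both sides are
continuous on the open slab (the similarity maps the slab into itself) and agree a.e., hence everywhere
(`Measure.eqOn_open_of_ae_eq`).  Gap (i) between stmt-8561 as typed and its printed pointwise rungs. [folklore] -/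
theorem rdssInvariant_pointwise_of_classical
    {w : ℝ → EuclideanSpace ℝ (Fin 3) → EuclideanSpace ℝ (Fin 3)} {q : ℝ → EuclideanSpace ℝ (Fin 3) → ℝ}
    {l τ : ℝ} (R : EuclideanSpace ℝ (Fin 3) ≃ₗᵢ[ℝ] EuclideanSpace ℝ (Fin 3)) (ξ : EuclideanSpace ℝ (Fin 3))
    (hcl : IsClassicalNSSolutionOn (Set.Iio 0) 1 0 w q) (hl : 0 < l) (hτ : τ ≤ 0)
    (hinv : (fun z : ℝ × EuclideanSpace ℝ (Fin 3) => l • R.symm (w (l ^ 2 * z.1 + τ) (l • R z.2 + ξ)))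
      =ᵐ[volume.restrict (Iio (0 : ℝ) ×ˢ (univ : Set (EuclideanSpace ℝ (Fin 3))))]
      (fun z : ℝ × EuclideanSpace ℝ (Fin 3) => w z.1 z.2)) :
    ∀ t < (0 : ℝ), ∀ x : EuclideanSpace ℝ (Fin 3), l • R.symm (w (l ^ 2 * t + τ) (l • R x + ξ)) = w t x := by
  have hS : IsOpen (Iio (0 : ℝ) ×ˢ (univ : Set (EuclideanSpace ℝ (Fin 3)))) := isOpen_Iio.prod isOpen_univ
  have hwc : ContinuousOn (uncurry w) (Iio (0 : ℝ) ×ˢ univ) := hcl.smooth_velocity.continuousOn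
  -- the similarity as a continuous self-map of the slab
  set Φ : ℝ × EuclideanSpace ℝ (Fin 3) → ℝ × EuclideanSpace ℝ (Fin 3) :=
    fun z => (l ^ 2 * z.1 + τ, l • R z.2 + ξ) with hΦ
  have hΦc : Continuous Φ := by
    refine Continuous.prodMk ?_ ?_
    · exact (continuous_const.mul continuous_fst).add continuous_const
    · exact ((R.continuous.comp continuous_snd).const_smul l).add continuous_const
  have hΦmaps : MapsTo Φ (Iio (0 : ℝ) ×ˢ (univ : Set (EuclideanSpace ℝ (Fin 3))))
      (Iio (0 : ℝ) ×ˢ (univ : Set (EuclideanSpace ℝ (Fin 3)))) := by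
    rintro ⟨t, x⟩ ⟨ht, -⟩
    have ht' : t < 0 := ht
    refine ⟨?_, mem_univ _⟩
    show l ^ 2 * t + τ < 0
    have : l ^ 2 * t < 0 := mul_neg_of_pos_of_neg (by positivity) ht'
    linarith
  have hfc : ContinuousOn (fun z : ℝ × EuclideanSpace ℝ (Fin 3) => l • R.symm (w (l ^ 2 * z.1 + τ) (l • R z.2 + ξ)))
      (Iio (0 : ℝ) ×ˢ univ) := by
    have h1 : ContinuousOn (uncurry w ∘ Φ) (Iio (0 : ℝ) ×ˢ univ) := hwc.comp hΦc.continuousOn hΦmaps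
    have h2 : ContinuousOn (fun z => l • R.symm ((uncurry w ∘ Φ) z)) (Iio (0 : ℝ) ×ˢ univ) :=
      (R.symm.continuous.comp_continuousOn h1).const_smul l
    exact h2
  have hgc : ContinuousOn (fun z : ℝ × EuclideanSpace ℝ (Fin 3) => w z.1 z.2) (Iio (0 : ℝ) ×ˢ univ) := hwc
  have key := Measure.eqOn_open_of_ae_eq hinv hS hfc hgc
  intro t ht x
  exact key (show ((t, x) : ℝ × EuclideanSpace ℝ (Fin 3)) ∈ Iio (0 : ℝ) ×ˢ univ from ⟨ht, mem_univ _⟩)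

end Summit.NavierStokesRegularity.NavierStokesRegularity.Theorems.SymmetryModuliCountForcedSymmetry

end
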